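import Summits.Ventures.DiscreteObjects.Hadamard.CompositeOrder23
import Summits.Ventures.DiscreteObjects.Hadamard.PAF23
import Summits.Ventures.DiscreteObjects.Hadamard.FreeOrbits

/-!
# Hadamard 668 census, family F12 — order 161, fixed-point-free type: the row relations of the `7`-fixed `23`-orbit (kernel)

Framing: lottery ticket; floor = certified bounds/negative ranges.

Cell pub-namedobj (venture DiscreteObjects), target (H), hadamard gen 11 (FAMILY-F12-G10 §8(m), kernel version).  Let `(π, κ)` be
a permutation automorphism pair of a Hadamard matrix `H` of order `668` of order `161`; by `order161_forces_fpf` the `23`-part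
`(π^7, κ^7)` fixes exactly one row `r₀` and one column `c₀`, and the `7`-part `(π^23, κ^23)` fixes `r₀`, `c₀` and exactly one
whole `23`-orbit of rows `Ω_r` and of columns `Ω_c` pointwise.  Fix `x₀ ∈ Ω_r`.  This file proves (`order161_row_relations`):
* the periodic autocorrelations of the row `x₀` along `Ω_c` satisfy `7 ∣ 1 + PAF(s)` (`s = 1..22`): orthogonality of `x₀` with
  `σ^s x₀` splits as `1` (column `c₀`) `+ PAF(s)` (`Ω_c`) `+` a sum over the `644` columns moved by `κ^23`, which is `κ^23`-orbit-wise
  constant, hence `≡ 0 (mod 7)` (`dvd_sum_moved`); so by the PAF lemma (`paf23_sum_eq_pm_one`) the block sum `a** = ∑_{Ω_c} H x₀ = ±1`;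
* orthogonality of `x₀` with the fixed row `r₀` then gives `e₀ + ε a** ≡ 0 (mod 7)` with `e₀, ε = ±1`, so `e₀ + ε a** = 0` and
  **`∑_{κ^23 j ≠ j} H r₀ j · H x₀ j = 0`**;
* summing the `23` autocorrelation identities: **`∑_{κ^23 j ≠ j} H x₀ j · T(j) = 644`**, `T(j) = ∑_{s<23} H x₀ (σ^s j)` (`668 − 23 − a**²`).
These two sums feed the orbit count of `CompositeOrder161`.  Ours, not literature; no `sorry`.
-/

namespace Summit.Ventures.DiscreteObjects.Hadamard

open Finset BigOperators Matrix

open Literature.Combinatorics.Designs.GoethalsSeidel (IsHadamardMatrix)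

variable {ι : Type*} [Fintype ι] [DecidableEq ι]

omit [Fintype ι] [DecidableEq ι] in
/-- powers of powers of one permutation commute pointwise -/
lemma pow_pow_comm_apply (κ : Equiv.Perm ι) (a b i : ℕ) (y : ι) :
    (κ ^ a) (((κ ^ b) ^ i) y) = ((κ ^ b) ^ i) ((κ ^ a) y) := by
  rw [← pow_mul]; exact perm_pow_comm_apply κ a (b * i) y

omit [Fintype ι] [DecidableEq ι] in
/-- a nontrivial power below `23` of a permutation of order `23` moves every moved point -/
lemma free_of_order23 (σ : Equiv.Perm ι) (hσ : σ ^ 23 = 1) {y : ι} (hy : σ y ≠ y) :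
    ∀ k, 0 < k → k < 23 → (σ ^ k) y ≠ y := by
  intro k hk0 hk hfix
  have hcop : Nat.Coprime k 23 :=
    Nat.Coprime.symm ((Nat.Prime.coprime_iff_not_dvd (by norm_num)).mpr (Nat.not_dvd_of_pos_of_lt hk0 hk))
  exact hy (perm_fixed_of_pow_coprime σ hcop (by norm_num) hfix (by rw [hσ]; rfl))

section row
variable {H : Matrix ι ι ℤ} {π κ : Equiv.Perm ι}

/-- **Row relations in the fixed-point-free type of order 161.**  See the module docstring. -/
theorem order161_row_relations (hH : IsHadamardMatrix H) (hι : Fintype.card ι = 668)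
    (hA : ∀ i j, H (π i) (κ j) = H i j) (hπ : π ^ 161 = 1) (hκ : κ ^ 161 = 1)
    (hσ : π ^ 7 ≠ 1 ∨ κ ^ 7 ≠ 1) (hh : π ^ 23 ≠ 1 ∨ κ ^ 23 ≠ 1) :
    ∃ c₀ r₀ x₀ : ι, (κ ^ 7) c₀ = c₀ ∧ (κ ^ 23) c₀ = c₀ ∧ (∀ j, (κ ^ 7) j = j → j = c₀) ∧
      (π ^ 7) r₀ = r₀ ∧ (π ^ 23) r₀ = r₀ ∧ (π ^ 7) x₀ ≠ x₀ ∧ (π ^ 23) x₀ = x₀ ∧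
      (univ.filter fun j => (κ ^ 23) j = j).card = 24 ∧
      ∑ j ∈ univ.filter (fun j => ¬ (κ ^ 23) j = j),
          H x₀ j * (∑ s ∈ Finset.range 23, H x₀ (((κ ^ 7) ^ s) j)) = 644 ∧
      ∑ j ∈ univ.filter (fun j => ¬ (κ ^ 23) j = j), H r₀ j * H x₀ j = 0 := by
  obtain ⟨f1r, f1c, -, f24c, o23r, o23c⟩ := order161_forces_fpf hH hι hA hπ hκ hσ hh
  have hκ7 : (κ ^ 7) ^ 23 = 1 := by rw [← pow_mul]; exact hκ
  have hκ23 : (κ ^ 23) ^ 7 = 1 := by rw [← pow_mul]; exact hκ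
  have hπ7 : (π ^ 7) ^ 23 = 1 := by rw [← pow_mul]; exact hπ
  have hA7 : ∀ i j, H ((π ^ 7) i) ((κ ^ 7) j) = H i j := aut_pow_apply (fun i j => H i j) π κ hA 7
  have hA23 : ∀ i j, H ((π ^ 23) i) ((κ ^ 23) j) = H i j := aut_pow_apply (fun i j => H i j) π κ hA 23
  -- the fixed column c₀ and the fixed row r₀
  obtain ⟨c₀, hc₀⟩ := Finset.card_eq_one.mp f1c
  have hc₀uniq : ∀ j, (κ ^ 7) j = j → j = c₀ := by
    intro j hj
    have : j ∈ univ.filter (fun j => (κ ^ 7) j = j) := by simp [hj]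
    rw [hc₀] at this
    exact Finset.mem_singleton.mp this
  have hc₀fix : (κ ^ 7) c₀ = c₀ := by
    have : c₀ ∈ univ.filter (fun j => (κ ^ 7) j = j) := by rw [hc₀]; exact Finset.mem_singleton_self c₀
    simpa using this
  have hc₀h : (κ ^ 23) c₀ = c₀ := hc₀uniq _ (by rw [perm_pow_comm_apply κ 7 23 c₀, hc₀fix])
  obtain ⟨r₀, hr₀⟩ := Finset.card_eq_one.mp f1r
  have hr₀uniq : ∀ i, (π ^ 7) i = i → i = r₀ := by
    intro i hi
    have : i ∈ univ.filter (fun i => (π ^ 7) i = i) := by simp [hi]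
    rw [hr₀] at this
    exact Finset.mem_singleton.mp this
  have hr₀fix : (π ^ 7) r₀ = r₀ := by
    have : r₀ ∈ univ.filter (fun i => (π ^ 7) i = i) := by rw [hr₀]; exact Finset.mem_singleton_self r₀
    simpa using this
  have hr₀h : (π ^ 23) r₀ = r₀ := hr₀uniq _ (by rw [perm_pow_comm_apply π 7 23 r₀, hr₀fix])
  -- a row x₀ of the h-fixed 23-orbit and a column y₀ of the h-fixed 23-orbit
  obtain ⟨x₀, hx₀⟩ := Finset.card_pos.mp (by rw [o23r]; norm_num :
    0 < (univ.filter fun i => (π ^ 7) i ≠ i ∧ (π ^ 23) i = i).card)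
  simp only [Finset.mem_filter, Finset.mem_univ, true_and] at hx₀
  set Ωc := univ.filter (fun j => (κ ^ 7) j ≠ j ∧ (κ ^ 23) j = j) with hΩc
  obtain ⟨y₀, hy₀⟩ := Finset.card_pos.mp (by rw [o23c]; norm_num : 0 < Ωc.card)
  have hy₀' : (κ ^ 7) y₀ ≠ y₀ ∧ (κ ^ 23) y₀ = y₀ := by simpa [hΩc] using hy₀
  -- invariances of the rows x₀ and r₀
  have hu23 : ∀ (i : ℕ) (y : ι), H x₀ (((κ ^ 23) ^ i) y) = H x₀ y := by
    intro i y
    conv_lhs => rw [← perm_pow_apply_of_fixed (π ^ 23) hx₀.2 i]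
    exact aut_pow_apply (fun i j => H i j) (π ^ 23) (κ ^ 23) hA23 i x₀ y
  have hE23 : ∀ (i : ℕ) (y : ι), H r₀ (((κ ^ 23) ^ i) y) = H r₀ y := by
    intro i y
    conv_lhs => rw [← perm_pow_apply_of_fixed (π ^ 23) hr₀h i]
    exact aut_pow_apply (fun i j => H i j) (π ^ 23) (κ ^ 23) hA23 i r₀ y
  have hE7 : ∀ (s : ℕ) (y : ι), H r₀ (((κ ^ 7) ^ s) y) = H r₀ y := by
    intro s y
    conv_lhs => rw [← perm_pow_apply_of_fixed (π ^ 7) hr₀fix s]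
    exact aut_pow_apply (fun i j => H i j) (π ^ 7) (κ ^ 7) hA7 s r₀ y
  -- Ω_c is the κ^7-orbit of each of its points
  have hΩorb : ∀ y ∈ Ωc, orbFin (κ ^ 7) 23 y = Ωc := by
    intro y hy
    have hy' : (κ ^ 7) y ≠ y ∧ (κ ^ 23) y = y := by simpa [hΩc] using hy
    apply Finset.eq_of_subset_of_card_le
    · intro x hx
      have hmoved := moved_of_mem_orbFin (κ ^ 7) hκ7 hy'.1 hx
      obtain ⟨i, -, rfl⟩ := Finset.mem_image.mp hx
      simp only [hΩc, Finset.mem_filter, Finset.mem_univ, true_and]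
      exact ⟨hmoved, by rw [pow_pow_comm_apply κ 23 7 i y, hy'.2]⟩
    · rw [o23c, card_orbFin (κ ^ 7) (by norm_num) hκ7 hy'.1]
  have horb : ∀ y ∈ Ωc, ∀ f : ι → ℤ, ∑ s ∈ Finset.range 23, f (((κ ^ 7) ^ s) y) = ∑ x ∈ Ωc, f x := by
    intro y hy f
    have hy' : (κ ^ 7) y ≠ y := (by simpa [hΩc] using hy : (κ ^ 7) y ≠ y ∧ (κ ^ 23) y = y).1
    rw [← hΩorb y hy, sum_orbFin_of_free (free_of_order23 (κ ^ 7) hκ7 hy') f]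
  have hinv : ∀ (s : ℕ) (f : ι → ℤ), ∑ x ∈ Ωc, f (((κ ^ 7) ^ s) x) = ∑ x ∈ Ωc, f x := by
    intro s f
    rw [← hΩorb y₀ hy₀]
    exact sum_orbFin_comp_pow (by norm_num) hκ7 y₀ s f
  have hmem : ∀ (s : ℕ), ∀ x ∈ Ωc, ((κ ^ 7) ^ s) x ∈ Ωc := by
    intro s x hx
    rw [← hΩorb x hx]
    exact pow_apply_mem_orbFin _ (by norm_num) hκ7 x s
  -- three-way split of sums over all columns
  have hnotmem : c₀ ∉ Ωc := by simp [hΩc, hc₀fix]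
  have hfix24 : (univ.filter fun j => (κ ^ 23) j = j) = insert c₀ Ωc := by
    symm
    apply Finset.eq_of_subset_of_card_le
    · intro j hj
      rcases Finset.mem_insert.mp hj with rfl | hj
      · simp [hc₀h]
      · have hj' : (κ ^ 7) j ≠ j ∧ (κ ^ 23) j = j := by simpa [hΩc] using hj
        simp [hj'.2]
    · rw [f24c, Finset.card_insert_of_notMem hnotmem, o23c]
  have split3 : ∀ F : ι → ℤ, ∑ j, F j
      = F c₀ + ∑ j ∈ Ωc, F j + ∑ j ∈ univ.filter (fun j => ¬ (κ ^ 23) j = j), F j := by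
    intro F
    rw [← Finset.sum_filter_add_sum_filter_not univ (fun j => (κ ^ 23) j = j) F, hfix24,
      Finset.sum_insert hnotmem]
  -- the autocorrelation identities A(s) = 0 for 0 < s < 23
  have hAzero : ∀ s, 0 < s → s < 23 → ∑ j, H x₀ j * H x₀ (((κ ^ 7) ^ s) j) = 0 := by
    intro s hs0 hs23
    have hxs : ((π ^ 7) ^ s) x₀ ≠ x₀ := free_of_order23 (π ^ 7) hπ7 hx₀.1 s hs0 hs23
    have horth : ∑ j, H (((π ^ 7) ^ s) x₀) j * H x₀ j = 0 := hadamard_row_orth H hH hxs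
    rw [← Equiv.sum_comp ((κ ^ 7) ^ s) (fun j => H (((π ^ 7) ^ s) x₀) j * H x₀ j)] at horth
    have hA7s : ∀ j, H (((π ^ 7) ^ s) x₀) (((κ ^ 7) ^ s) j) = H x₀ j :=
      fun j => aut_pow_apply (fun i j => H i j) (π ^ 7) (κ ^ 7) hA7 s x₀ j
    simp only [hA7s] at horth
    exact horth
  -- 7 ∣ 1 + PAF(s)
  have hPAF : ∀ s : ℕ, 0 < s → s < 23 → (7 : ℤ) ∣ 1 + ∑ x ∈ Ωc, H x₀ x * H x₀ (((κ ^ 7) ^ s) x) := by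
    intro s hs0 hs23
    have hAs := hAzero s hs0 hs23
    rw [split3, perm_pow_apply_of_fixed _ hc₀fix s, pm_mul_self (hH.1 x₀ c₀)] at hAs
    have hY : (7 : ℤ) ∣ ∑ j ∈ univ.filter (fun j => (κ ^ 23) j ≠ j), H x₀ j * H x₀ (((κ ^ 7) ^ s) j) :=
      dvd_sum_moved (κ ^ 23) (by norm_num) hκ23 (fun j => H x₀ j * H x₀ (((κ ^ 7) ^ s) j)) (by
        intro y _ i
        show H x₀ (((κ ^ 23) ^ i) y) * H x₀ (((κ ^ 7) ^ s) (((κ ^ 23) ^ i) y))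
          = H x₀ y * H x₀ (((κ ^ 7) ^ s) y)
        rw [hu23 i y, ← pow_mul, ← pow_mul, perm_pow_comm_apply κ (7 * s) (23 * i) y, pow_mul κ 23 i, hu23 i])
    have e : 1 + ∑ x ∈ Ωc, H x₀ x * H x₀ (((κ ^ 7) ^ s) x)
        = -(∑ j ∈ univ.filter (fun j => (κ ^ 23) j ≠ j), H x₀ j * H x₀ (((κ ^ 7) ^ s) j)) := by
      have : (univ.filter fun j => (κ ^ 23) j ≠ j) = univ.filter fun j => ¬ (κ ^ 23) j = j := rfl
      rw [this]; linarith
    rw [e]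
    exact (dvd_neg).mpr hY
  -- the PAF lemma: a** = ±1
  have hstar := paf23_sum_eq_pm_one Ωc o23c (κ ^ 7) hmem horb hinv (fun x => H x₀ x) (fun x _ => hH.1 x₀ x) hPAF
  refine ⟨c₀, r₀, x₀, hc₀fix, hc₀h, hc₀uniq, hr₀fix, hr₀h, hx₀.1, hx₀.2, f24c, ?_, ?_⟩
  · -- ∑_Y u T = 644 from ∑_s A(s) = 668
    have hsumA : ∑ s ∈ Finset.range 23, ∑ j, H x₀ j * H x₀ (((κ ^ 7) ^ s) j) = 668 := by
      rw [Finset.sum_range_succ']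
      have h0 : ∑ j, H x₀ j * H x₀ (((κ ^ 7) ^ 0) j) = 668 := by
        simp only [pow_zero, Equiv.Perm.coe_one, id_eq]
        rw [hadamard_row_self H hH x₀, hι]; norm_num
      rw [h0, Finset.sum_eq_zero (fun s hs => hAzero (s + 1) (Nat.succ_pos s)
        (by have := Finset.mem_range.mp hs; omega))]
      norm_num
    rw [Finset.sum_comm] at hsumA
    rw [Finset.sum_congr rfl fun j _ => (Finset.mul_sum _ _ _).symm] at hsumA
    rw [split3 (fun j => H x₀ j * ∑ s ∈ Finset.range 23, H x₀ (((κ ^ 7) ^ s) j))] at hsumA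
    -- the c₀ term is 23 and the Ω_c term is a**² = 1
    have hc0 : H x₀ c₀ * ∑ s ∈ Finset.range 23, H x₀ (((κ ^ 7) ^ s) c₀) = 23 := by
      rw [Finset.sum_congr rfl fun s _ => by rw [perm_pow_apply_of_fixed _ hc₀fix s], Finset.sum_const,
        Finset.card_range, nsmul_eq_mul, ← mul_assoc, mul_comm (H x₀ c₀), mul_assoc, pm_mul_self (hH.1 x₀ c₀)]
      norm_num
    have hΩ : ∑ x ∈ Ωc, H x₀ x * ∑ s ∈ Finset.range 23, H x₀ (((κ ^ 7) ^ s) x) = 1 := by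
      rw [Finset.sum_congr rfl fun x hx => by rw [horb x hx (fun j => H x₀ j)], ← Finset.sum_mul]
      rcases hstar with h | h <;> rw [h] <;> norm_num
    rw [hc0, hΩ] at hsumA
    linarith
  · -- ∑_Y E u = 0 from the orthogonality of r₀ and x₀
    have hne : r₀ ≠ x₀ := fun h => hx₀.1 (by rw [← h]; exact hr₀fix)
    have horth := hadamard_row_orth H hH hne
    rw [split3] at horth
    have hΩ : ∑ x ∈ Ωc, H r₀ x * H x₀ x = H r₀ y₀ * ∑ x ∈ Ωc, H x₀ x := by
      rw [← horb y₀ hy₀ (fun x => H r₀ x * H x₀ x), ← horb y₀ hy₀ (fun x => H x₀ x), Finset.mul_sum]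
      apply Finset.sum_congr rfl
      intro s _
      rw [hE7 s y₀]
    have hY : (7 : ℤ) ∣ ∑ j ∈ univ.filter (fun j => (κ ^ 23) j ≠ j), H r₀ j * H x₀ j :=
      dvd_sum_moved (κ ^ 23) (by norm_num) hκ23 (fun j => H r₀ j * H x₀ j) (by
        intro y _ i
        show H r₀ (((κ ^ 23) ^ i) y) * H x₀ (((κ ^ 23) ^ i) y) = H r₀ y * H x₀ y
        rw [hu23 i y, hE23 i y])
    have e : (univ.filter fun j => (κ ^ 23) j ≠ j) = univ.filter fun j => ¬ (κ ^ 23) j = j := rfl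
    rw [e] at hY
    rw [hΩ] at horth
    obtain ⟨t, ht⟩ := hY
    rw [ht] at horth ⊢
    have h1 := hH.1 r₀ c₀
    have h2 := hH.1 x₀ c₀
    have h3 := hH.1 r₀ y₀
    rcases h1 with h1 | h1 <;> rcases h2 with h2 | h2 <;> rcases h3 with h3 | h3 <;>
      rcases hstar with h4 | h4 <;> rw [h1, h2, h3, h4] at horth <;> omega

end row

end Summit.Ventures.DiscreteObjects.Hadamard
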